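import Literature.Probability.LatticeModels.IsingDisorderLaplacian
import HarnessLib

/-!
# The boundary modification trick for the Kadanoff–Ceva primitive

Topic `Literature/Probability/LatticeModels`; continues `IsingDisorderLaplacian.lean` (the discrete
primitive `H = (Hw, Hb)` of the critical Kadanoff–Ceva fermion: existence on hole-free plaquette
sets, `Δ Hw ≤ 0` at free sites, `Δ Hb ≥ 0` at plaquettes with four touching sides, `Hw` constant on
frozen sites), supplying the piece listed there as missing: Chelkak–Hongler–Izyurov 2015, Prop. 3.6
(ii)–(iii) / Chelkak–Smirnov 2012, §3.6, Lemma 3.14 (the "boundary modification trick") /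
Chelkak–Hongler–Izyurov 2021, Remark 4.7 and Lemma 4.8: at a plaquette `f` some of whose sides are
FROZEN bonds (both endpoints outside `Λ`; there the wired boundary condition (2.4) holds in the form
`X(w₁, T_f) = X(w₂, T_f)`, `kcCorner_of_notMem`), the black Laplacian in which each frozen side
contributes the modified term `2(√2 - 1)·(Hw|_{frozen} - Hb f) = -2(√2 - 1)·X(w, T_f)²` (conductance
`2 tan(π/8)` towards the Dirichlet value, Chelkak–Smirnov's two artificial half-angle rhombi) is still
a sum of two squares:

* `kc_black_laplacian_boundary`: for `f ∈ P` with an odd number of cut sides, touching sides `Jt`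
  leading to plaquettes of `P` and the other sides frozen with equal boundary spins,
  `∑_{j ∈ Jt} (Φ_out j - Φ_in j) - 2(√2-1) ∑_{j ∉ Jt} Φ_in j = P₁² + Q₁² ≥ 0`.

The proof is the one of `kc_black_laplacian`: the frozen side `j` is never in the cut
(`cut f ⊆ edgesTouching`), so its sign is `+1`, its two corner values coincide, and the toggle
identity (valid for every bond) gives the would-be outer value `(√2 - 1)·X`, whose flux difference
`((√2-1)² - 1) X² = -2(√2-1) X²` is exactly the modified term. Everything is proved; no named fact.

## References

* D. Chelkak, C. Hongler, K. Izyurov, Ann. of Math. 181 (2015): Prop. 3.6 (ii)–(iii), eq. (2.4)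
  [ChelkakHonglerIzyurovAnnals2015].
* D. Chelkak, S. Smirnov, Invent. Math. 189 (2012) = arXiv:0910.2045: §3.6, Lemma 3.14
  [ChelkakSmirnov2012].
* D. Chelkak, C. Hongler, K. Izyurov, arXiv:2103.10263: Remark 4.7, Lemma 4.8 [ChelkakHonglerIzyurov2021].
-/

noncomputable section

open MeasureTheory Finset

namespace Literature.Probability.LatticeModels

variable (G₂ : SimpleGraph (Site 2)) [G₂.LocallyFinite]

/-- **The black Laplacian with the boundary modification is a sum of two squares** (Chelkak–Smirnov
2012, Lemma 3.14 / Chelkak–Hongler–Izyurov 2015, Prop. 3.6 (iii), Kadanoff–Ceva form). Let `f ∈ P`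
carry a cut with an odd number of cut sides; let the sides `j ∈ Jt` touch `Λ` and lead to plaquettes
of `P`, and let every other side be frozen (both endpoints outside `Λ`) with equal boundary spins.
Then `∑_{j ∈ Jt} (Φ(v_j, outer) - Φ(v_j, inner)) + ∑_{j ∉ Jt} (-2(√2-1)) Φ(v_j, inner) = P₁² + Q₁²`.
[cite: ChelkakSmirnov2012, Lemma 3.14; ChelkakHonglerIzyurovAnnals2015, Prop. 3.6] -/
theorem kc_black_laplacian_boundary {Λ : Finset (Site 2)} (η : SpinConfig (Site 2)) (B : Finset (Site 2))
    {cut : Site 2 → Finset (Sym2 (Site 2))} {P : Set (Site 2)} (h : IsKCCuts G₂ Λ cut P)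
    {f : Site 2} (hf : f ∈ P) (Jt : Finset (Fin 4))
    (ht : ∀ j ∈ Jt, s(f + cornerOff j, f + cornerOff j + cornerUnit j) ∈ edgesTouching G₂ Λ ∧ f + cornerUnit (j + 3) ∈ P)
    (hfz : ∀ j ∉ Jt, f + cornerOff j ∉ Λ ∧ f + cornerOff j + cornerUnit j ∉ Λ ∧
      spinAt (f + cornerOff j) η = spinAt (f + cornerOff j + cornerUnit j) η)
    (hodd : Odd #(Finset.univ.filter fun j : Fin 4 =>
      s(f + cornerOff j, f + cornerOff j + cornerUnit j) ∈ cut f)) :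
    ∃ P₁ Q₁ : ℝ,
      (∑ j ∈ Jt, (kcFlux G₂ Λ criticalBetaTwo (.fixed η) B cut (f + cornerOff j, j + 3) -
          kcFlux G₂ Λ criticalBetaTwo (.fixed η) B cut (f + cornerOff j, j))) +
        ∑ j ∈ Jtᶜ, (-(2 * (Real.sqrt 2 - 1))) * kcFlux G₂ Λ criticalBetaTwo (.fixed η) B cut (f + cornerOff j, j) =
        P₁ ^ 2 + Q₁ ^ 2 := by
  set X : Finset (Sym2 (Site 2)) → Site 2 → ℝ := fun T v => kcCorner G₂ Λ criticalBetaTwo (.fixed η) B T v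
    with hX
  set T := cut f with hT
  set v : Fin 4 → Site 2 := fun j => f + cornerOff j with hv
  set sd : Fin 4 → Sym2 (Site 2) := fun j => s(v j, v j + cornerUnit j) with hsd
  have hTsub : T ⊆ edgesTouching G₂ Λ := h.subset _ hf
  have hvs : ∀ j : Fin 4, v j + cornerUnit j = v (j + 1) := fun j => (add_cornerOff_succ f j).symm
  -- the would-be outer values `Y_j = √2 a_j - σ_j a_{j+1}` (the toggle identity, valid for every bond)
  set Y : Fin 4 → ℝ := fun j => Real.sqrt 2 * X T (v j) - kcSign T (sd j) * X T (v (j + 1)) with hY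
  have rel : ∀ j : Fin 4, X (symmDiff T {sd j}) (v j) = Y j := by
    intro j
    simp only [hY]
    rw [← hvs j]
    exact kcCorner_symmDiff_singleton_critical G₂ Λ _ B T (v j) (v j + cornerUnit j)
  have flux_in : ∀ j : Fin 4, kcFlux G₂ Λ criticalBetaTwo (.fixed η) B cut (f + cornerOff j, j) = X T (v j) ^ 2 := by
    intro j
    simp only [kcFlux, cFace, hX, hT, hv, faceAt_add_cornerOff]
  -- touching sides: the genuine outer flux is `Y_j²`
  have key_t : ∀ j ∈ Jt, kcFlux G₂ Λ criticalBetaTwo (.fixed η) B cut (f + cornerOff j, j + 3) -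
      kcFlux G₂ Λ criticalBetaTwo (.fixed η) B cut (f + cornerOff j, j) = Y j ^ 2 - X T (v j) ^ 2 := by
    intro j hj
    obtain ⟨hek, hPj⟩ := ht j hj
    have h1 : faceAt (v j) j = f := faceAt_add_cornerOff f j
    have h2 : faceAt (v j) (j + 3) = f + cornerUnit (j + 3) := faceAt_face_corner_add_three f j
    have hstep : KCGaugeEquiv G₂ Λ (symmDiff T {sd j}) (cut (f + cornerUnit (j + 3))) := by
      rcases h.step (v j) j (h1 ▸ hf) (h2 ▸ hPj) with ⟨-, S, hS, hcut⟩ | ⟨hu, hu'⟩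
      · rw [h1, h2] at hcut
        exact ⟨S, hS, hcut⟩
      · exfalso
        rw [mem_edgesTouching_iff] at hek
        obtain ⟨-, x, hx, hxe⟩ := hek
        rcases Sym2.mem_iff.1 hxe with rfl | rfl
        · exact hu hx
        · exact hu' hx
    have hsub := symmDiff_singleton_subset_edgesTouching G₂ hTsub hek
    have flux_out : kcFlux G₂ Λ criticalBetaTwo (.fixed η) B cut (f + cornerOff j, j + 3) = X (symmDiff T {sd j}) (v j) ^ 2 := by
      simp only [kcFlux, cFace, faceAt_face_corner_add_three]
      exact hstep.kcCorner_sq G₂ hsub _ η B (v j)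
    rw [flux_out, flux_in, rel]
  -- frozen sides: sign `+1`, equal corner values, `Y_j = (√2 - 1) a_j`
  have key_f : ∀ j ∉ Jt, (-(2 * (Real.sqrt 2 - 1))) * kcFlux G₂ Λ criticalBetaTwo (.fixed η) B cut (f + cornerOff j, j) =
      Y j ^ 2 - X T (v j) ^ 2 := by
    intro j hj
    obtain ⟨hu, hu', hspin⟩ := hfz j hj
    have hnot : sd j ∉ T := by
      intro hmem
      have := hTsub hmem
      rw [mem_edgesTouching_iff] at this
      obtain ⟨-, x, hx, hxe⟩ := this
      rcases Sym2.mem_iff.1 hxe with rfl | rfl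
      · exact hu hx
      · exact hu' hx
    have hsign : kcSign T (sd j) = 1 := by simp [kcSign, hnot]
    have heq : X T (v (j + 1)) = X T (v j) := by
      rw [← hvs j]
      simp only [hX]
      rw [kcCorner_of_notMem G₂ Λ _ η B T hu', kcCorner_of_notMem G₂ Λ _ η B T hu, hspin]
    rw [flux_in]
    simp only [hY]
    rw [hsign, heq]
    have hs : Real.sqrt 2 ^ 2 = 2 := Real.sq_sqrt zero_le_two
    linear_combination (-(X T (v j) ^ 2)) * hs
  -- assemble the full sum over the four sides
  have hsum : (∑ j ∈ Jt, (kcFlux G₂ Λ criticalBetaTwo (.fixed η) B cut (f + cornerOff j, j + 3) -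
          kcFlux G₂ Λ criticalBetaTwo (.fixed η) B cut (f + cornerOff j, j))) +
        ∑ j ∈ Jtᶜ, (-(2 * (Real.sqrt 2 - 1))) * kcFlux G₂ Λ criticalBetaTwo (.fixed η) B cut (f + cornerOff j, j) =
      ∑ j : Fin 4, (Y j ^ 2 - X T (v j) ^ 2) := by
    rw [Finset.sum_congr rfl key_t, Finset.sum_congr rfl (fun j hj => key_f j (Finset.mem_compl.1 hj)),
      Finset.sum_add_sum_compl]
  rw [hsum]
  -- the product of the four signs is `-1`
  have hprod : kcSign T (sd 0) * kcSign T (sd 1) * kcSign T (sd 2) * kcSign T (sd 3) = -1 := by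
    have hp : ∏ j : Fin 4, kcSign T (sd j) = (-1) ^ #(Finset.univ.filter fun j : Fin 4 => sd j ∈ T) := by
      simp only [kcSign]
      rw [prod_ite, prod_const, prod_const_one, mul_one]
    rw [Fin.prod_univ_four] at hp
    rw [hp]
    exact Odd.neg_one_pow hodd
  rw [Fin.sum_univ_four]
  simp only [hY]
  have e3 : (3 : Fin 4) + 1 = 0 := rfl
  simp only [show (0 : Fin 4) + 1 = 1 from rfl, show (1 : Fin 4) + 1 = 2 from rfl,
    show (2 : Fin 4) + 1 = 3 from rfl, e3]
  have core := kc_laplacian_core (X T (v 0)) (X T (v 3)) (X T (v 2)) (X T (v 1))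
    (kcSign T (sd 0)) (kcSign T (sd 3)) (kcSign T (sd 2)) (kcSign T (sd 1))
    (kcSign_eq_one_or T _) (kcSign_eq_one_or T _) (kcSign_eq_one_or T _) (kcSign_eq_one_or T _)
    (by linear_combination hprod)
  have q₀ := kcSign_mul_self T (sd 0)
  have q₁ := kcSign_mul_self T (sd 1)
  have q₂ := kcSign_mul_self T (sd 2)
  have q₃ := kcSign_mul_self T (sd 3)
  have hs : Real.sqrt 2 ^ 2 = 2 := Real.sq_sqrt zero_le_two
  refine ⟨Real.sqrt 2 * kcSign T (sd 3) * X T (v 3) - X T (v 0) - kcSign T (sd 3) * kcSign T (sd 2) * X T (v 2),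
    Real.sqrt 2 * kcSign T (sd 3) * kcSign T (sd 2) * kcSign T (sd 1) * X T (v 1) + X T (v 0) -
      kcSign T (sd 3) * kcSign T (sd 2) * X T (v 2), ?_⟩
  linear_combination -core + (X T (v 1) ^ 2) * q₀ + (X T (v 2) ^ 2) * q₁ + (X T (v 3) ^ 2) * q₂ +
    (X T (v 0) ^ 2) * q₃ + (X T (v 0) ^ 2 + X T (v 1) ^ 2 + X T (v 2) ^ 2 + X T (v 3) ^ 2) * hs

end Literature.Probability.LatticeModels
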